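import Summits.ResolutionOfSingularities.KangarooAtlas.MizutaniHSchemeCriterion
import Summits.ResolutionOfSingularities.KangarooAtlas.MizutaniOdaDuality
import HarnessLib

/-!
# Comparing the levels: `𝒟_e ≤ 𝒟_{e+1}`, `𝒥_{e+1} ≤ 𝒥_e`, and the closure `𝒥_e𝒟_e ≤ 𝒥_{e+1}𝒟_{e+1}` reduced to Mizutani's Lemma 2.4

Cell `pub-rosobs`, Mizutani enclosure (seat mizutani-encloser-1, gen 9).  AI-written; *AI review is weaker than
expert review*; NOT a resolution-of-singularities theorem (summit relevance C).

Mizutani 1973, Lemma 2.7 («the image `F^{e−e'}(H)` of an H-scheme by the Frobenius of the ambient vector group is an H-scheme of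
exponent `e'`») rests on the inclusion **`𝒥_{e'}𝒟_{e'}(V) ⊆ 𝒥_e𝒟_e(V)` for `e' ≤ e`**, which Mizutani derives from Lemma 2.4
(`Diff_{p^e−1}(k)V = Diff_{p^e−p^{e'}}(k)·Diff_{p^{e'}−1}(k)V`) and Oda's `𝒟𝒥𝒟 = 𝒟`.  With `exists_isPoint_invForms_eq_iff`
(`MizutaniHSchemeCriterion`) that inclusion says exactly: the level-`e` invariant forms `(L_B)_e(𝔭)` of a point of exponent `≤ e` are the
level-`e'` invariant forms of a point of exponent `≤ e'` (the point of `F^{e−e'}(B(𝔭))`).  This file proves the comparison lemmas that do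
NOT need Lemma 2.4 and REDUCES the inclusion to Lemma 2.4 in a form about pairs of vectors (left for a successor):

* `restrictLevel` — an operator of `k` over `k^{p^e}` viewed over `k^{p^{e+1}} ⊆ k^{p^e}`, same order (`isDiffOpLE_restrictLevel`); hence
  **`dSpan_le_dSpan_succ`** (`𝒟_e(V) ≤ 𝒟_{e+1}(V)`) and **`jCore_succ_le_jCore`** (`𝒥_{e+1}(U) ≤ 𝒥_e(U)`);
* `isDiffOpLE_baseChange` — for `D₀ ∈ Diff_m(k/K)`, `1 ⊗ D₀` is a differential operator of order `≤ m` of the `k`-algebra `k ⊗_K k`, so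
  `(1 ⊗ D₀)(J^N) ⊆ J^{N−m}` (`baseChange_mem_ideal_pow_sub`); `tensorDown` — the projection `k ⊗_{k^{p^{e+1}}} k → k ⊗_{k^{p^e}} k`
  (`tensorDown_tens`, `tensorDown_mem_ideal_pow`);
* **`apply_mem_orth_dSpan`** — if `Σ v_i ⊗ c_i ∈ J_{e+1}^{p^{e+1}}` for all `v ∈ V` then `D₀ c ⊥ 𝒟_e(V)` for every
  `D₀ ∈ Diff_{p^{e+1}−p^e}(k/k^{p^{e+1}})`;
* **`jCore_dSpan_le_succ_of_lemma24`** — `𝒥_e𝒟_e(V) ≤ 𝒥_{e+1}𝒟_{e+1}(V)` FOLLOWS from the pair statement «if `Σ_i D'(a_i)·D₀(c_i) = 0` for all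
  `D' ∈ Diff_{p^e−1}(k/k^{p^e})`, `D₀ ∈ Diff_{p^{e+1}−p^e}(k/k^{p^{e+1}})`, then `Σ a_i ⊗ c_i ∈ J_{e+1}^{p^{e+1}}`» — Mizutani's Lemma 2.4 in dual
  form (by `mem_ideal_pow_iff_forall_dPair` it says `Diff_{p^{e+1}−1}` is «spanned» by the products `Diff_{p^e−1}∘Diff_{p^{e+1}−p^e}` as far as
  pairings see); and `exists_isPoint_invForms_eq_pred_of_lemma24` — the point half of Lemma 2.7 (one Frobenius step) under the same
  hypothesis.  The hypothesis is NOT proved here (see the seat's NOTES: a root-tower/Lucas computation).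

References: H. Mizutani, Nagoya Math. J. 52 (1973), Lemma 2.4, Lemma 2.7 [Mizutani1973HironakaGroupSchemes]; T. Oda, Publ. RIMS 19
(1983), §1 (p. 1165), Lemma 2.9 of [O1] as used on p. 89 [Oda1983HironakaGroupSchemeII]; EGA IV 16.8.8 [EGAIV4].
-/

noncomputable section

open MvPolynomial TensorProduct Literature.AlgebraicGeometry.Resolution
  Literature.AlgebraicGeometry.Resolution.HironakaScheme

namespace Summit.ResolutionOfSingularities.KangarooAtlas.Mizutani

universe u

/-! ## Operators of level `e` are operators of level `e + 1` -/

section Restrict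

variable (k : Type u) [Field k] (p : ℕ) [hp : Fact p.Prime] [CharP k p] {n : ℕ} (e : ℕ)

/-- A `k^{p^e}`-linear map of `k` viewed as a `k^{p^{e+1}}`-linear map (`k^{p^{e+1}} ⊆ k^{p^e}`). [folklore] -/
def restrictLevel (D : k →ₗ[frobPow k p e] k) : k →ₗ[frobPow k p (e + 1)] k where
  toFun := D
  map_add' x y := map_add D x y
  map_smul' c x := by
    have hc : (c : k) ∈ frobPow k p e := frobPow_anti (Nat.le_succ e) c.2
    have := D.map_smul (⟨(c : k), hc⟩ : frobPow k p e) x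
    rw [Subfield.smul_def, Subfield.smul_def] at this
    rw [RingHom.id_apply, Subfield.smul_def, Subfield.smul_def]
    exact this

/-- `restrictLevel D x = D x`. [folklore] -/
@[simp] theorem restrictLevel_apply (D : k →ₗ[frobPow k p e] k) (x : k) : restrictLevel k p e D x = D x := rfl

/-- The order of a differential operator does not depend on the base subfield. [cite: EGAIV4, Prop. 16.8.8] -/
theorem isDiffOpLE_restrictLevel {m : ℕ} {D : k →ₗ[frobPow k p e] k} (hD : IsDiffOpLE (frobPow k p e) m D) :
    IsDiffOpLE (frobPow k p (e + 1)) m (restrictLevel k p e D) :=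
  IsDiffOpLE.of_ringEquiv (RingEquiv.refl k) m D (restrictLevel k p e D) (fun _ => rfl) hD

/-- **`𝒟_e(V) ≤ 𝒟_{e+1}(V)`** (`Diff_{p^e−1}(k/k^{p^e}) ⊆ Diff_{p^{e+1}−1}(k/k^{p^{e+1}})`). [cite: Mizutani1973HironakaGroupSchemes, §1 (b)] -/
theorem dSpan_le_dSpan_succ (V : Submodule k (Fin (n + 1) → k)) : dSpan k p e V ≤ dSpan k p (e + 1) V := by
  unfold dSpan
  refine Submodule.span_mono ?_
  rintro _ ⟨v, hv, D, hD, rfl⟩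
  refine ⟨v, hv, restrictLevel k p e D, (isDiffOpLE_restrictLevel k p e hD).of_le ?_, rfl⟩
  exact Nat.sub_le_sub_right (Nat.pow_le_pow_right hp.out.pos (Nat.le_succ e)) 1

/-- **`𝒥_{e+1}(U) ≤ 𝒥_e(U)`.** [cite: Mizutani1973HironakaGroupSchemes, §1 (b)] -/
theorem jCore_succ_le_jCore (U : Submodule k (Fin (n + 1) → k)) : jCore k p (e + 1) U ≤ jCore k p e U := by
  intro a ha D hD
  exact ha (restrictLevel k p e D) ((isDiffOpLE_restrictLevel k p e hD).of_le
    (Nat.sub_le_sub_right (Nat.pow_le_pow_right hp.out.pos (Nat.le_succ e)) 1))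

/-- Hence `(L_B)_e(𝔭)`, which is `𝒥_e𝒟_e`-closed, satisfies `𝒥_{e+1}𝒟_{e+1}((L_B)_e) ⊆ 𝒥_e(𝒟_{e+1}((L_B)_e))` etc.; the useful
consequence: a `𝒥_{e+1}𝒟_{e+1}`-closed subspace is `𝒥_e𝒟_{e+1}`… — we only record the trivial inclusion
`𝒥_{e+1}(𝒟_e V) ≤ 𝒥_e(𝒟_{e+1} V)`. [folklore] -/
theorem jCore_succ_dSpan_le (V : Submodule k (Fin (n + 1) → k)) :
    jCore k p (e + 1) (dSpan k p e V) ≤ jCore k p e (dSpan k p (e + 1) V) :=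
  (jCore_succ_le_jCore k p e _).trans (jCore_mono k p e (dSpan_le_dSpan_succ k p e V))

end Restrict

/-! ## `1 ⊗ D₀` is a differential operator of the tensor square; the projection to the lower level -/

section Tensor

variable (K : Type*) {k : Type u} [Field K] [Field k] [Algebra K k]

/-- `[D, a + b] = [D, a] + [D, b]`. [folklore] -/
private theorem commMul_add_right' {R A : Type*} [CommSemiring R] [CommRing A] [Algebra R A] (D : A →ₗ[R] A) (a b : A) :
    commMul R D (a + b) = commMul R D a + commMul R D b := by
  ext t; simp only [commMul_apply, LinearMap.add_apply, add_mul, map_add]; ring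

/-- `[D, 0] = 0`. [folklore] -/
private theorem commMul_zero_right' {R A : Type*} [CommSemiring R] [CommRing A] [Algebra R A] (D : A →ₗ[R] A) :
    commMul R D 0 = 0 := by
  ext t; simp only [commMul_apply, zero_mul, map_zero, sub_zero, LinearMap.zero_apply]

/-- For `D₀ ∈ Diff_m(k/K)`, the operator `1 ⊗ D₀` of the `k`-algebra `k ⊗_K k` (left structure) has order `≤ m`:
`[1 ⊗ D₀, x ⊗ y] = (x ⊗ 1)·(1 ⊗ [D₀, y])`. [cite: EGAIV4, Prop. 16.8.8] -/
theorem isDiffOpLE_baseChange : ∀ (m : ℕ) {D₀ : k →ₗ[K] k}, IsDiffOpLE K m D₀ →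
    IsDiffOpLE k m (D₀.baseChange k : k ⊗[K] k →ₗ[k] k ⊗[K] k)
  | 0, D₀, hD => by
    rw [isDiffOpLE_zero_iff_eq_mulLeft] at hD ⊢
    refine TensorProduct.AlgebraTensorModule.ext fun x y => ?_
    rw [LinearMap.baseChange_tmul, LinearMap.mulLeft_apply, Algebra.TensorProduct.one_def, LinearMap.baseChange_tmul,
      Algebra.TensorProduct.tmul_mul_tmul, one_mul]
    conv_lhs => rw [hD, LinearMap.mulLeft_apply]
  | m + 1, D₀, hD => by
    intro w
    -- `[1 ⊗ D₀, w]` for `w = Σ x_j ⊗ y_j` is `Σ (x_j ⊗ 1) • (1 ⊗ [D₀, y_j])`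
    induction w using TensorProduct.induction_on with
    | zero => rw [commMul_zero_right']; exact IsDiffOpLE.zero m
    | tmul x y =>
      have hxy : commMul k (D₀.baseChange k) (x ⊗ₜ[K] y) =
          (x ⊗ₜ[K] (1 : k)) • ((commMul K D₀ y).baseChange k : k ⊗[K] k →ₗ[k] k ⊗[K] k) := by
        refine TensorProduct.AlgebraTensorModule.ext fun u v => ?_
        simp only [commMul_apply, LinearMap.smul_apply, LinearMap.baseChange_tmul, Algebra.TensorProduct.tmul_mul_tmul,
          smul_eq_mul, one_mul, TensorProduct.tmul_sub, mul_sub]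
      rw [hxy]
      exact (isDiffOpLE_baseChange m (hD y)).smul _
    | add w₁ w₂ h₁ h₂ => rw [commMul_add_right']; exact IsDiffOpLE.add h₁ h₂

/-- **`(1 ⊗ D₀)(J^N) ⊆ J^{N−m}`** for `D₀ ∈ Diff_m(k/K)`. [cite: EGAIV4, Prop. 16.8.8 (with 16.8.8.2)] -/
theorem baseChange_mem_ideal_pow_sub {m N : ℕ} {D₀ : k →ₗ[K] k} (hD : IsDiffOpLE K m D₀) {w : k ⊗[K] k}
    (hw : w ∈ KaehlerDifferential.ideal K k ^ N) : D₀.baseChange k w ∈ KaehlerDifferential.ideal K k ^ (N - m) :=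
  IsDiffOpLE.apply_mem_pow_sub (KaehlerDifferential.ideal K k) N (isDiffOpLE_baseChange K m hD) hw

end Tensor

section Down

variable (k : Type u) [Field k] (p : ℕ) [hp : Fact p.Prime] [CharP k p] {n : ℕ} (e : ℕ)

/-- The projection `k ⊗_{k^{p^{e+1}}} k → k ⊗_{k^{p^e}} k`, `x ⊗ y ↦ x ⊗ y` (the base gets bigger), as an additive map. [folklore] -/
def tensorDownAdd : k ⊗[frobPow k p (e + 1)] k →+ k ⊗[frobPow k p e] k :=
  TensorProduct.liftAddHom
    { toFun := fun x =>
        { toFun := fun y => x ⊗ₜ[frobPow k p e] y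
          map_zero' := TensorProduct.tmul_zero _ _
          map_add' := fun y y' => TensorProduct.tmul_add _ _ _ }
      map_zero' := by ext y; exact TensorProduct.zero_tmul _ _
      map_add' := fun x x' => by ext y; exact TensorProduct.add_tmul _ _ _ }
    (by
      intro c x y
      have hc : (c : k) ∈ frobPow k p e := frobPow_anti (Nat.le_succ e) c.2
      show (c • x) ⊗ₜ[frobPow k p e] y = x ⊗ₜ[frobPow k p e] (c • y)
      rw [Subfield.smul_def, Subfield.smul_def, smul_eq_mul, smul_eq_mul]
      have h1 : ((c : k) * x) ⊗ₜ[frobPow k p e] y = ((⟨(c : k), hc⟩ : frobPow k p e) • x) ⊗ₜ[frobPow k p e] y := rfl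
      have h2 : x ⊗ₜ[frobPow k p e] ((c : k) * y) = x ⊗ₜ[frobPow k p e] ((⟨(c : k), hc⟩ : frobPow k p e) • y) := rfl
      rw [h1, h2, TensorProduct.smul_tmul])

/-- `tensorDownAdd (x ⊗ y) = x ⊗ y`. [folklore] -/
@[simp] theorem tensorDownAdd_tmul (x y : k) :
    tensorDownAdd k p e (x ⊗ₜ[frobPow k p (e + 1)] y) = x ⊗ₜ[frobPow k p e] y := by
  unfold tensorDownAdd; rw [TensorProduct.liftAddHom_tmul]; rfl

/-- **The projection `k ⊗_{k^{p^{e+1}}} k → k ⊗_{k^{p^e}} k` as a ring homomorphism.** [folklore] -/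
def tensorDown : k ⊗[frobPow k p (e + 1)] k →+* k ⊗[frobPow k p e] k where
  toFun := tensorDownAdd k p e
  map_one' := by rw [Algebra.TensorProduct.one_def, tensorDownAdd_tmul, ← Algebra.TensorProduct.one_def]
  map_mul' w w' := by
    induction w using TensorProduct.induction_on with
    | zero => rw [zero_mul, map_zero, zero_mul]
    | tmul x y =>
      induction w' using TensorProduct.induction_on with
      | zero => rw [mul_zero, map_zero, mul_zero]
      | tmul x' y' =>
        rw [Algebra.TensorProduct.tmul_mul_tmul, tensorDownAdd_tmul, tensorDownAdd_tmul, tensorDownAdd_tmul,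
          Algebra.TensorProduct.tmul_mul_tmul]
      | add a b ha hb => rw [mul_add, map_add, map_add, ha, hb, mul_add]
    | add a b ha hb => rw [add_mul, map_add, map_add, ha, hb, add_mul]
  map_zero' := map_zero _
  map_add' := map_add _

/-- `tensorDown (x ⊗ y) = x ⊗ y`. [folklore] -/
@[simp] theorem tensorDown_tmul (x y : k) : tensorDown k p e (x ⊗ₜ[frobPow k p (e + 1)] y) = x ⊗ₜ[frobPow k p e] y :=
  tensorDownAdd_tmul k p e x y

/-- `tensorDown (tens_{e+1} a b) = tens_e a b`. [folklore] -/
theorem tensorDown_tens (a b : Fin (n + 1) → k) : tensorDown k p e (tens k p (e + 1) a b) = tens k p e a b := by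
  unfold tens
  rw [map_sum]
  exact Finset.sum_congr rfl fun i _ => tensorDown_tmul k p e _ _

/-- The projection maps `J_{e+1}^N` into `J_e^N`. [folklore] -/
theorem tensorDown_mem_ideal_pow {N : ℕ} {w : k ⊗[frobPow k p (e + 1)] k} (hw : w ∈ KaehlerDifferential.ideal (frobPow k p (e + 1)) k ^ N) :
    tensorDown k p e w ∈ KaehlerDifferential.ideal (frobPow k p e) k ^ N := by
  have hle : (KaehlerDifferential.ideal (frobPow k p (e + 1)) k).map (tensorDown k p e) ≤ KaehlerDifferential.ideal (frobPow k p e) k := by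
    rw [← KaehlerDifferential.span_range_eq_ideal, Ideal.map_span, Ideal.span_le]
    rintro _ ⟨_, ⟨s, rfl⟩, rfl⟩
    rw [SetLike.mem_coe, map_sub, tensorDown_tmul, tensorDown_tmul]
    exact KaehlerDifferential.one_smul_sub_smul_one_mem_ideal _ s
  have h := Ideal.mem_map_of_mem (tensorDown k p e) hw
  rw [Ideal.map_pow] at h
  exact Ideal.pow_right_mono hle N h

/-! ## The reduction of `𝒥_e𝒟_e ≤ 𝒥_{e+1}𝒟_{e+1}` to Lemma 2.4 -/

/-- **If `Σ v_i ⊗ c_i ∈ J_{e+1}^{p^{e+1}}` for all `v ∈ V`, then `D₀ c ⊥ 𝒟_e(V)` for every `D₀ ∈ Diff_{p^{e+1}−p^e}(k/k^{p^{e+1}})`**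
(`(1 ⊗ D₀)` lowers the `J`-adic order by at most `p^{e+1} − p^e`, then project to level `e`). [cite: Mizutani1973HironakaGroupSchemes, Lemma 2.4 (proof)] -/
theorem apply_mem_orth_dSpan (V : Submodule k (Fin (n + 1) → k)) {c : Fin (n + 1) → k}
    (hc : ∀ v ∈ V, tens k p (e + 1) v c ∈ KaehlerDifferential.ideal (frobPow k p (e + 1)) k ^ p ^ (e + 1))
    {D₀ : k →ₗ[frobPow k p (e + 1)] k} (hD₀ : IsDiffOpLE (frobPow k p (e + 1)) (p ^ (e + 1) - p ^ e) D₀) :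
    (fun i => D₀ (c i)) ∈ orth k (dSpan k p e V) := by
  rw [mem_orth_dSpan_iff]
  intro v hv
  have h1 := baseChange_mem_ideal_pow_sub (frobPow k p (e + 1)) hD₀ (hc v hv)
  have hsub : p ^ (e + 1) - (p ^ (e + 1) - p ^ e) = p ^ e :=
    Nat.sub_sub_self (Nat.pow_le_pow_right hp.out.pos (Nat.le_succ e))
  rw [hsub] at h1
  have h2 : D₀.baseChange k (tens k p (e + 1) v c) = tens k p (e + 1) v (fun i => D₀ (c i)) := by
    unfold tens
    rw [map_sum]
    exact Finset.sum_congr rfl fun i _ => by rw [LinearMap.baseChange_tmul]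
  rw [h2] at h1
  have h3 := tensorDown_mem_ideal_pow k p e h1
  rwa [tensorDown_tens] at h3

/-- **`𝒥_e𝒟_e(V) ≤ 𝒥_{e+1}𝒟_{e+1}(V)` from Lemma 2.4 in dual form.**  Hypothesis `h24`: for every pair `(a, c)`, if
`Σ_i D'(a_i)·D₀(c_i) = 0` for all `D' ∈ Diff_{p^e−1}(k/k^{p^e})` and all `D₀ ∈ Diff_{p^{e+1}−p^e}(k/k^{p^{e+1}})`, then `Σ a_i ⊗ c_i ∈ J_{e+1}^{p^{e+1}}`.
[cite: Mizutani1973HironakaGroupSchemes, Lemma 2.4 and proof of Lemma 2.7 (𝒥_{e'}𝒟_{e'}(V) ⊂ 𝒥_e𝒟_e(V))] -/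
theorem jCore_dSpan_le_succ_of_lemma24
    (h24 : ∀ a c : Fin (n + 1) → k,
      (∀ (D' : k →ₗ[frobPow k p e] k) (D₀ : k →ₗ[frobPow k p (e + 1)] k), IsDiffOpLE (frobPow k p e) (p ^ e - 1) D' →
        IsDiffOpLE (frobPow k p (e + 1)) (p ^ (e + 1) - p ^ e) D₀ → ∑ i, D' (a i) * D₀ (c i) = 0) →
      tens k p (e + 1) a c ∈ KaehlerDifferential.ideal (frobPow k p (e + 1)) k ^ p ^ (e + 1))
    (V : Submodule k (Fin (n + 1) → k)) : jCore k p e (dSpan k p e V) ≤ jCore k p (e + 1) (dSpan k p (e + 1) V) := by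
  intro a ha
  rw [mem_jCore_dSpan_iff]
  intro c hc
  refine h24 a c fun D' D₀ hD' hD₀ => ?_
  have hperp := apply_mem_orth_dSpan k p e V hc hD₀
  rw [← orth_orth k (dSpan k p e V), mem_jCore_orth_iff] at ha
  exact (forall_sum_apply_mul_eq_zero_iff k p e a _).mpr (ha _ hperp) D' hD'

/-- **The point half of Lemma 2.7, one Frobenius step, from Lemma 2.4**: if `V` is `(L_B)_{e+1}` of a point of exponent `≤ e + 1`, then `V` is
`(L_B)_e` of a point of exponent `≤ e` (the point of `F(B)`), granted the dual form of Lemma 2.4 at level `e`.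
[cite: Mizutani1973HironakaGroupSchemes, Lemma 2.7] -/
theorem exists_isPoint_invForms_eq_pred_of_lemma24
    (h24 : ∀ a c : Fin (n + 1) → k,
      (∀ (D' : k →ₗ[frobPow k p e] k) (D₀ : k →ₗ[frobPow k p (e + 1)] k), IsDiffOpLE (frobPow k p e) (p ^ e - 1) D' →
        IsDiffOpLE (frobPow k p (e + 1)) (p ^ (e + 1) - p ^ e) D₀ → ∑ i, D' (a i) * D₀ (c i) = 0) →
      tens k p (e + 1) a c ∈ KaehlerDifferential.ideal (frobPow k p (e + 1)) k ^ p ^ (e + 1))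
    {V : Submodule k (Fin (n + 1) → k)}
    (hV : ∃ 𝔭 : Ideal (MvPolynomial (Fin (n + 1)) k), IsPoint k 𝔭 ∧ ExponentLE k p 𝔭 (e + 1) ∧ invForms k p 𝔭 (e + 1) = V) :
    ∃ 𝔮 : Ideal (MvPolynomial (Fin (n + 1)) k), IsPoint k 𝔮 ∧ ExponentLE k p 𝔮 e ∧ invForms k p 𝔮 e = V := by
  obtain ⟨hne, hcl⟩ := (exists_isPoint_invForms_eq_iff k p (e + 1) V).mp hV
  refine (exists_isPoint_invForms_eq_iff k p e V).mpr ⟨hne, le_antisymm ?_ (le_jCore_dSpan k p e V)⟩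
  calc jCore k p e (dSpan k p e V) ≤ jCore k p (e + 1) (dSpan k p (e + 1) V) := jCore_dSpan_le_succ_of_lemma24 k p e h24 V
    _ = V := hcl

end Down

end Summit.ResolutionOfSingularities.KangarooAtlas.Mizutani

end
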